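import Summits.NavierStokesRegularity.NavierStokesRegularity.Theses.LebesgueExponentPincer
import Summits.NavierStokesRegularity.NavierStokesRegularity.Theses.SubcubicESS
import Summits.NavierStokesRegularity.NavierStokesRegularity.Theorems.SubcubicESSUniformESSClosure
import HarnessLib.Audit

/-!
# Birth skeleton (BC3) of the crux `LebesgueExponentPincer.StrongCriticalityBreaking`

(crux item `stmt-NavierStokesRegularity-19241`, rank 3, kind crux — the DECLARED RESIDUAL conjunct
of route `route-NavierStokesRegularity-LebesgueExponentPincer`; tree path
`Cruxes/StrongCriticalityBreaking/Lines/birth.lean`; registrar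
`planner-skel-stmt-NavierStokesRegularity-19241-0`, 2026-08-17, route re-audit bin HONEST. It files,
as the route's crux workfile, the two-layer plan announced in the route header ("StrongCriticalityBreaking
⇐ PolynomialBound → BreakingOfPolynomialBound (Lebesgue interpolation, 3/δ law) → StrongCriticalityBreaking"),
which the opening planner `planner-type-b6f4c85dbd-0` had registered from its folder but could not write
here. No `Disproof.lean` exists for this crux (crux dir empty at registration); negatives index read
2026-08-17: 5 refuted statements on the summit, none about polynomial ESS bounds or supercritical
`L^{3-δ}` criteria.)

THE CRUX (verbatim `Theses.LebesgueExponentPincer.StrongCriticalityBreaking`). There is `δ ∈ (0,1)` such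
that for all `ν, T > 0`, every classical solution `(u,p)` of unforced Navier–Stokes on `ℝ³ × [0,T)`
which is Leray–Hopf from its rapidly decaying datum `u 0` and has
`⨆_{t ∈ [0,T)} ‖u(t)‖_{L^{3-δ}} < ⊤` extends smoothly past `T` — Barker–Prange's STRONG criticality
breaking (arXiv:2012.09776; survey arXiv:2211.16215 §9: only mild breaking `δ = δ(M,A) → 0` is in
print). It is an open problem; this file claims no progress on it, it certifies that the crux has a
typed two-layer anatomy whose open node is a registered item of another route.

THE CUT = "pay for the supercritical gap with a RATE in the critical theory":

* `stub_polynomialBound` [OPEN, conjecture-grade, SHARED: verbatim (by name) the open crux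
  `Theses.SubcubicESS.PolynomialBound` = item stmt-NavierStokesRegularity-10672 of route SubcubicESS,
  worked by that route's crux chain]: a POLYNOMIAL quantitative Escauriaza–Seregin–Šverák bound — there
  are `C, k` with `|u(t,x)| ≤ C A^k t^{-1/2}` on `(0,T]` for every Tao-class solution (`ν = 1`, all
  `‖∇ⁿu(t)‖_{L²}` bounded on `[0,T]`) with `sup_{[0,T]} ‖u(t)‖_{L³} ≤ A`, `A ≥ 2`. Known: triple
  exponential (Tao 2021, arXiv:1908.04958 Thm 1.2, in tree as the named fact
  `Literature.Analysis.FluidPDE.tao_quantitative_ess`); double exponential for axisymmetric `u`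
  (Palasek, arXiv:2101.08586 Thm 1). Why it might fail: as its own item says — `F_*(A)` may be
  super-polynomial (nested constant-Reynolds cascades `A^{1+n/2}` with no known depth cap; each of
  Tao's three exponentials may be essential, Rmk 1.5).
* `stub_threeOverDeltaLaw` [PROVABLE NOW, size M–L (≈ 200 lines on the template of the landed
  `Theorems.subcubicESS_energyBridge_proof`, file `Theorems/SubcubicESSEnergyBridge.lean`)]: THE 3/δ LAW
  — under a polynomial ESS bound of order `k` (the statement of stub 1 for fixed `C, k`, taken as a
  hypothesis) and `0 < δ < 1` with `k·δ < 3`, every classical solution with viscosity `ν > 0` on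
  `ℝ³ × [0,T)`, Leray–Hopf from its rapidly decaying datum, with `⨆_{t<T} ‖u(t)‖_{L^{3-δ}} < ⊤` has
  `⨆_{t<T} ‖u(t)‖_{L³} < ⊤`. Proof plan (Lebesgue interpolation against the rate, replacing the
  energy–Hölder line of the bridge): on closed slabs `[0,T']` the solution is in Tao's class
  (`Theorems.subcubicESS_closedSlab`, from `tao2011_hasBoundedSobolevNormsOn_holds`) with finite
  `N' = sup_{[0,T']} ‖u‖₃` (`Theorems.subcubicESS_eLpNorm_three_le_of_closedSlab`); the velocity clause
  at viscosity `ν` (`Theorems.subcubicESS_norm_le_of_velocity_bound` with `F A = C A^k`,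
  `A = max 2 (ν⁻¹N')`) gives `‖u(t)‖_∞ ≤ ν C A^k (ν t₀)^{-1/2}` on `[t₀,T']`, `t₀ = T/2`; the
  interpolation `‖u‖₃³ ≤ ‖u‖_∞^δ ‖u‖_{3-δ}^{3-δ}` (pointwise `|u|³ = |u|^δ |u|^{3-δ}`, `lintegral_mono`)
  then yields `N'³ ≤ max(N₀³, M^{3-δ} (ν C (νt₀)^{-1/2})^δ A^{kδ})` with `M` the `L^{3-δ}` bound, i.e.
  `A^{3-kδ} ≤ K` with `K` independent of `T' < T`; since `3 - kδ > 0` this bounds `A`, hence `N'`,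
  uniformly in `T'` (WLOG `C ≥ 1`, `k ≥ 0` by monotonicity of the hypothesis in `C, k` for `A ≥ 2`;
  for `C ≤ 0` the hypothesis forces `u ≡ 0` on `[t₀,T']`). Why it might fail: it should not — it is
  the standard supercritical-to-critical transfer by interpolation; formalisation risk only (real-power
  bookkeeping `Real.rpow`, `ENNReal.ofReal`).

COMPOSITION. `StrongCriticalityBreaking_of : StrongCriticalityBreaking` — the ONLY theorem of this file
concluding the crux, BY NAME, no `Prop` hypotheses — is a real proof using the two stubs by name: take
`C, k` from stub 1, put `δ := 1/(|k|+2)` (so `0 < δ < 1` and `kδ ≤ |k|/(|k|+2) < 1 < 3`), get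
`⨆_{t<T} ‖u(t)‖₃ < ⊤` from stub 2, and conclude with the PROVED support item `UniformESSClosure` of route
SubcubicESS (`Theorems.subcubicESS_uniformESSClosure_proof`, the `L³` continuation criterion run with the
abstract size function `F A := C A^k` supplied by stub 1 — so neither Tao's named fact nor the ESS named
fact `hasSmoothExtensionPast_of_eLpNorm_three_bounded` is assumed). `sorry` occurs ONLY inside the two
`stub_*`. The CLOSED twin `StrongCriticalityBreaking_of_hyps : S₁ → S₂ → StrongCriticalityBreaking`
(stub statements as hypotheses; zero placeholders) is the registrar's folder evidence
`bc/StrongCriticalityBreaking_birth_closed.lean`.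

NUMBERS (the 3/δ law). Stub 1 of order `k` gives the crux for every `δ < min(1, 3/k)` (`k > 0`); the
composition fixes one admissible `δ = 1/(|k|+2)`. With Tao's triple-exponential `F` in place of `C A^k`
the same argument closes nothing (no power of `A` absorbs `exp exp exp(A^{O(1)})^δ`), which is why the
open node is exactly the RATE.

BC3 PROBES (registrar folder `bc/probe_*.lean`, same imports as this file): for each stub statement `S`,
`S → StrongCriticalityBreaking` and `S → NavierStokesRegularity` by `first | exact? | simpa | aesop` FAIL
(4/4); results quoted in the registrar's NOTES.md and in the evidence note.
-/

noncomputable section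

open Set MeasureTheory

namespace Summit.NavierStokesRegularity.NavierStokesRegularity.Cruxes.StrongCriticalityBreaking.Birth

set_option linter.unusedVariables false
set_option linter.dupNamespace false

/-- **stub 1 — `stub_polynomialBound` (OPEN, conjecture-grade; SHARED = item
stmt-NavierStokesRegularity-10672, crux `PolynomialBound` of route SubcubicESS, stated BY NAME).**
Polynomial quantitative ESS: `∃ C k, ∀ T A u p`, Tao-class on `[0,T]` (`ν = 1`), `‖u(t)‖₃ ≤ A` on
`[0,T]`, `A ≥ 2` ⇒ `|u(t,x)| ≤ C A^k t^{-1/2}` for `0 < t ≤ T`. Known: `exp exp exp(A^{O(1)})`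
(Tao 2021 Thm 1.2, arXiv:1908.04958); `exp exp(A^{O(1)})` axisymmetric (arXiv:2101.08586 Thm 1). -/
theorem stub_polynomialBound :
    Summit.NavierStokesRegularity.NavierStokesRegularity.Theses.SubcubicESS.PolynomialBound := by
  sorry

/-- **stub 2 — `stub_threeOverDeltaLaw` (PROVABLE NOW, M–L: the 3/δ interpolation law).** For reals
`C, k, δ` with `0 < δ < 1` and `k·δ < 3`: IF every Tao-class solution (`ν = 1`, all Sobolev norms
bounded on `[0,T]`) with `‖u(t)‖₃ ≤ A` on `[0,T]`, `A ≥ 2`, obeys `|u(t,x)| ≤ C A^k t^{-1/2}` on `(0,T]`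
(stub 1 at fixed `C, k`), THEN every classical solution with viscosity `ν > 0` on `ℝ³ × [0,T)`,
Leray–Hopf from its rapidly decaying datum, with `⨆_{t<T} ‖u(t)‖_{L^{3-δ}} < ⊤` has
`⨆_{t<T} ‖u(t)‖_{L³} < ⊤`. Template: `Theorems.subcubicESS_energyBridge_proof` with the Hölder line
`‖u‖₃³ ≤ ‖u‖_∞‖u‖₂²` replaced by `‖u‖₃³ ≤ ‖u‖_∞^δ ‖u‖_{3-δ}^{3-δ}` and the `o(A³)` endgame replaced by
power counting `A^{3-kδ} ≤ K` (`Theorems.subcubicESS_closedSlab`,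
`Theorems.subcubicESS_eLpNorm_three_le_of_closedSlab`, `Theorems.subcubicESS_norm_le_of_velocity_bound`). -/
theorem stub_threeOverDeltaLaw :
    ∀ C k δ : ℝ, 0 < δ → δ < 1 → k * δ < 3 →
      (∀ (T A : ℝ) (u : ℝ → EuclideanSpace ℝ (Fin 3) → EuclideanSpace ℝ (Fin 3))
          (p : ℝ → EuclideanSpace ℝ (Fin 3) → ℝ),
        (Literature.Analysis.FluidPDE.IsClassicalNSSolutionOn (Set.Icc 0 T) 1 0 u p ∧
            ∀ n : ℕ, ∃ C : NNReal, ∀ t ∈ Set.Icc 0 T,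
              MeasureTheory.eLpNorm (iteratedFDeriv ℝ n (u t)) 2 MeasureTheory.volume ≤ C) →
        (∀ t ∈ Set.Icc 0 T, MeasureTheory.eLpNorm (u t) 3 MeasureTheory.volume ≤ ENNReal.ofReal A) →
        2 ≤ A → ∀ t ∈ Set.Ioc 0 T, ∀ x : EuclideanSpace ℝ (Fin 3),
          ‖u t x‖ ≤ C * A ^ k * t ^ (-(1 / 2 : ℝ))) →
      ∀ (ν T : ℝ), 0 < ν → 0 < T →
        ∀ (u : ℝ → EuclideanSpace ℝ (Fin 3) → EuclideanSpace ℝ (Fin 3))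
          (p : ℝ → EuclideanSpace ℝ (Fin 3) → ℝ),
        Literature.Analysis.FluidPDE.IsClassicalNSSolutionOn (Set.Ico 0 T) ν 0 u p →
        Literature.Analysis.FluidPDE.IsLerayHopfOn T ν 0 (u 0) u →
        Literature.Analysis.FluidPDE.HasRapidSpatialDecay (u 0) →
        (⨆ t ∈ Set.Ico 0 T,
            MeasureTheory.eLpNorm (u t) (ENNReal.ofReal (3 - δ)) MeasureTheory.volume) < ⊤ →
        (⨆ t ∈ Set.Ico 0 T, MeasureTheory.eLpNorm (u t) 3 MeasureTheory.volume) < ⊤ := by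
  sorry

/-! ### Composition (kernel-checked, no `sorry` below this line) -/

/-- **Assembly: the crux BY NAME from the two registered stubs BY NAME** (the skeleton theorem read by
`#h21_check_skeleton`; no `Prop` hypotheses; no direct `sorry`). From stub 1 take `C, k`; with
`δ := 1/(|k|+2) ∈ (0,1)`, `kδ < 3`, stub 2 turns the bounded `L^{3-δ}` norm into a bounded `L³` norm
along the given classical Leray–Hopf solution, and the PROVED `UniformESSClosure`
(`Theorems.subcubicESS_uniformESSClosure_proof`, fed with `F A := C A^k` from stub 1) extends the
solution smoothly past `T`. -/
theorem StrongCriticalityBreaking_of :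
    Summit.NavierStokesRegularity.NavierStokesRegularity.Theses.LebesgueExponentPincer.StrongCriticalityBreaking := by
  have hpoly₀ := stub_polynomialBound
  unfold Summit.NavierStokesRegularity.NavierStokesRegularity.Theses.SubcubicESS.PolynomialBound at hpoly₀
  obtain ⟨C, k, hpoly⟩ := hpoly₀
  have hU := Summit.NavierStokesRegularity.NavierStokesRegularity.Theorems.subcubicESS_uniformESSClosure_proof
  unfold Summit.NavierStokesRegularity.NavierStokesRegularity.Theses.SubcubicESS.UniformESSClosure at hU
  have hpos : (0 : ℝ) < |k| + 2 := by positivity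
  have hδ0 : (0 : ℝ) < 1 / (|k| + 2) := by positivity
  have hδ1 : 1 / (|k| + 2) < (1 : ℝ) := by
    rw [div_lt_one hpos]
    linarith [abs_nonneg k]
  have hkδ : k * (1 / (|k| + 2)) < 3 := by
    rw [mul_one_div, div_lt_iff₀ hpos]
    linarith [le_abs_self k, abs_nonneg k]
  unfold Summit.NavierStokesRegularity.NavierStokesRegularity.Theses.LebesgueExponentPincer.StrongCriticalityBreaking
  refine ⟨1 / (|k| + 2), hδ0, hδ1, ?_⟩
  intro ν T hν hT u p hsol hLH h₀ hsup
  have hL3 : (⨆ t ∈ Set.Ico 0 T, MeasureTheory.eLpNorm (u t) 3 MeasureTheory.volume) < ⊤ :=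
    stub_threeOverDeltaLaw C k (1 / (|k| + 2)) hδ0 hδ1 hkδ hpoly ν T hν hT u p hsol hLH h₀ hsup
  exact hU ⟨fun A => C * A ^ k, hpoly⟩ ν T hν hT u p hsol hLH h₀ hL3

end Summit.NavierStokesRegularity.NavierStokesRegularity.Cruxes.StrongCriticalityBreaking.Birth

end
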